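import Literature.MathematicalPhysics.QuantumFieldTheory.Balaban1983to89.B9Thm311PositivityKnitLetter
import Literature.MathematicalPhysics.QuantumFieldTheory.Balaban1983to89.Node00.OpsYSectDReal

/-!
# `Balaban1983to89.B9B8KnitLetterRealityLeftInv` — (E14) REALITY and (U1) THE LEFT-INVERSE LAW of `G′(U) = Δ′_a(U)⁻¹` AT THE KNIT LETTER `parKnitY`:
# `G′` maps hermitian-valued functions to hermitian-valued functions, and `G′(Δ_U g + Q′ᵀ𝔄Q′ g) = g` read through the consumer's own letters at the
# points of the fundamental box (junction J-B file 12 — the two remaining ALGEBRAIC laws of `B8Thm2TorusLetters.LettersAt` for the letter `G′`)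

statement-level skeleton of published theorems with citation tags; proofs where landed; nothing here is a claim about the
Yang–Mills mass gap

T. Bałaban, *Propagators for lattice gauge theories in a background field*, Commun. Math. Phys. **99** (1985) 389–434 [`Balaban1985BackgroundPropagators`,
"[B9]"]; T. Bałaban, *Spaces of regular gauge field configurations on a lattice and gauge fixing conditions*, Commun. Math. Phys. **99** (1985) 75–102
[`Balaban1985RegularSpaces`, "[B8]"].

THE PRINT.  [B9] p. 391: *«The adjoints are taken with respect to natural L² scalar products for functions with values in N × N hermitian matrices»* —
every operator of Sect. 3 acts on hermitian-valued functions; (3.24) p. 394: `Δ′_a(U) = Δ_U + Σ_j a_j(Lʲη)⁻²Q′_j(U)*1_{Λ_j}Q′_j(U)`, p. 394: *«Its inverse is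
denoted by G′, or G′(U)»*, Thm 3.1 p. 397.  [B8] (1.95) p. 92, (1.100)–(1.102) p. 93, Prop. 5 p. 94: the gauge-fixing function `λ` solves `λ = G′(…)`, is
`𝔤`-valued (`u′ = e^{iλ}` unitary, (1.107)), and is UNIQUE — the consumer's `B8Thm2TorusLetters.LettersAt` records these as the laws (E14) `gp_real`
(`f` hermitian-valued ⇒ `G′f` hermitian-valued) and (U1) `gp_left_bdd` (`G′(Δg + Q′ᵀ𝔄Q′g) = g` on bounded `g`).

WHY THIS FILE ∕ THE ARGUMENT.  Junction J-B (lead RULINGS #3–#4) reads [B9]'s `G′` at print's composite-contour transporters `parKnitY` ([B7] (52)–(53)).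
Files 3 (`B9Thm311PositivityKnitLetter`: `Δ′_a(U; parKnitY)` positive, invertible, (E1) at box points) and 7–11 (coercivity, decay, resolvent transfer,
(E12)) leave two algebraic laws of the `G′`-letter.  (E14): def-Y's reality calculus `Node00.OpsYSectDReal` proves `T(Λ⋆) = (TΛ)⋆` for `Δ′_a(U; par)` and
its `Ring.inverse` at ANY unitary-valued site transporters `par` (`deltaPrimeAY_isRealOpY`, `GpY_isRealOpY`); the knit legs are `G`-valued with
`G ≤ U(N)` (file 4b `parKnitY_mem_of_pdev` supplies this on [B7]'s class (52)), so the calculus applies verbatim, and the `η²`-scaled consumer letter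
`GpKnitY = η²·G′` inherits it (`η² ∈ ℝ`).  (U1): on def-Y's finite carrier every function is bounded and `G′` is the two-sided inverse
(`GpY_deltaPrimeAY_parKnitY_apply`); junction file 2's `deltaPrime_junction_at_box` reads the consumer's `Δ_U g + Q′ᵀ𝔄Q′g` at a box point as
`η⁻²·(Δ′_a(U; parKnitY)Λ)(z)`, so `GpKnitY` applied to the consumer's expression returns `Λ` exactly; uniqueness of the solution of the consumer's
equation at box points follows.

CITATION HEADER (lean-in-tree rule).  Cell `lit-balaban`, sub-row G-B9-LETTERS, junction J-B file 12 → seat `lit-balaban-p33` gen 94.  REUSED BY NAME: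
`Node00.{IsRealOpY, deltaPrimeAY_isRealOpY, GpY_isRealOpY, IsRealOpY.smul_real, IsRealOpY.apply_eq_of_star_eq}` (def-Y's reality calculus `Node00.OpsYSectDReal`),
`B9Thm311DeltaPrimeSymm.conjTranspose_cdS` (dag-n06-j), `B9Thm311PositivityKnitLetter.{GpKnitY, GpKnitY_apply, GpY_deltaPrimeAY_parKnitY_apply,
deltaPrimeAY_GpY_parKnitY_apply}` (junction file 3), `B9B8DeltaPrimeJunction.deltaPrime_junction_at_box` (junction file 2), `B7Prop2Explicit.mem_unitaryUnits`.

WHAT THIS FILE PROVES (sorry-free; no definitions; nothing of [B9] asserted).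
* §1 `mem_unitary_of_mem`, `parKnitY_mem_unitary` (`G`-valued ⇒ unitary-valued, `G ≤ U(N)`); generic pointwise readings of def-Y's `IsRealOpY`:
  `star_eq_self_of_isSelfAdjoint`, `isSelfAdjoint_apply_of_isRealOpY` (hermitian in ⇒ hermitian out), `apply_eq_neg_star_of_isRealOpY` (the (E10)-shape:
  `Y = −X⋆ ⇒ TY = −(TX)⋆`).
* §2 ★ `deltaPrimeAY_parKnitY_isRealOpY`, ★ `GpY_parKnitY_isRealOpY`, ★ `GpKnitY_isRealOpY`; ★★★ **`isSelfAdjoint_GpKnitY_apply`** — (E14) `gp_real` AT THE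
  KNIT LETTER: for `G ≤ U(N)`, a `G`-valued `U` with `G`-valued knit legs, every `η` and every hermitian-valued `Λ`, `(GpKnitY η U Λ)(z)` is hermitian at
  every `z`; `isSelfAdjoint_GpY_parKnitY_apply` (the unscaled `G′`), `GpKnitY_apply_eq_neg_star` ((E10)-shape), `isSelfAdjoint_deltaPrimeAY_parKnitY_apply`
  (`Δ′_a` itself), `isSelfAdjoint_cdS_apply` ∕ `isSelfAdjoint_cdS_GpKnitY_apply` (the covariant gradient of a hermitian field, and of `G′Λ`, is hermitian).
* §3 ★★★ **`knit_U1_at_box`** — (U1) AT THE KNIT LETTER, EXACTLY: on a constant-level member, `η ≠ 0`, with `g = liftFun (Λ ∘ chart)` and `U₀ = liftCfg U`,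
  `GpKnitY η U (z ↦ covLap η U₀ g (z) + QT L n (torusLam n) U₀ (awOp (cKnit η) (j ↦ QprimeIter (zdBlocking (d+1) L) (bgT L U₀) j g)) (z)) = Λ`;
  `knit_solution_unique_at_box` (two data with the same consumer image at the box points coincide), `GpKnitY_injective`.

HONEST SCOPE.  Finite-dimensional algebra at def-Y's carrier; the reality statements need only `G ≤ U(N)` and `G`-valued legs (no smallness); (U1) is the
two-sided inverse on the finite torus, where boundedness is automatic — the consumer's «on bounded functions» proviso is vacuous here and is NOT a
statement about an infinite lattice.  Nothing continuum, nothing about OS axioms or the mass gap.  No `sorry`, no `axiom`, no `instance`, no `notation`.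
NEW file; nothing landed is modified.  Net new unproved facts: 0.  Seat `lit-balaban-p33` gen 94, 2026-08-28.
-/

noncomputable section

namespace Literature.MathematicalPhysics.QuantumFieldTheory.Balaban1983to89.B9B8KnitLetterRealityLeftInv

open Node00 B6KLevelCensusIndexV1 B6GlobalChartV1 B9BackgroundsKLevelV1 B9Eq39Adjoint B9Thm311ReadingCoords
open B7Eq78Linearization (QprimeIter zdBlocking)
open B8Eq119TwistedAxial (bgT)
open B8Eq138LandauZd (covLap QT)
open B8Thm4TorusAt (torusLam)
open B9B8CarrierDictionary (liftFun liftCfg)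
open B9B8AveragingJunction (parKnitY)
open B9B8DeltaPrimeJunction (awOp cKnit deltaPrime_junction_at_box)
open B9Thm311DeltaPrimeSymm (conjTranspose_cdS)
open B9Thm311PositivityKnitLetter (GpKnitY GpKnitY_apply GpY_deltaPrimeAY_parKnitY_apply deltaPrimeAY_GpY_parKnitY_apply)
open scoped Matrix Matrix.Norms.L2Operator

variable {d ℓ : ℕ} {hd : 1 ≤ d + 1} {hL : Odd (ℓ + 1) ∧ 1 < ℓ + 1} {b₀ b₁ : ℝ}

/-! ## §1 Unitary-valuedness of the letters; pointwise readings of the reality predicate -/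

section Generic

variable {𝔸 : Type*} [Ring 𝔸] [StarRing 𝔸] [Algebra ℂ 𝔸] {X Y : Type}

omit [Algebra ℂ 𝔸] in
/-- a hermitian-valued function is a fixed point of pointwise conjugation. [cite: Balaban1985BackgroundPropagators, p.391 («functions with values in N × N hermitian matrices»), bookkeeping] -/
theorem star_eq_self_of_isSelfAdjoint {Λ : X → 𝔸} (hΛ : ∀ w, IsSelfAdjoint (Λ w)) : star Λ = Λ :=
  funext fun w => (hΛ w).star_eq

/-- ★ a REAL operator (def-Y's `IsRealOpY`: `T(Λ⋆) = (TΛ)⋆`) maps hermitian-valued functions to hermitian-valued functions, pointwise.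
[cite: Balaban1985BackgroundPropagators, p.391 («functions with values in N × N hermitian matrices»)] -/
theorem isSelfAdjoint_apply_of_isRealOpY {T : (X → 𝔸) →ₗ[ℂ] (Y → 𝔸)} (hT : IsRealOpY T) {Λ : X → 𝔸} (hΛ : ∀ w, IsSelfAdjoint (Λ w)) (y : Y) :
    IsSelfAdjoint (T Λ y) := by
  have h := congrFun (hT.apply_eq_of_star_eq (star_eq_self_of_isSelfAdjoint hΛ)) y
  rwa [Pi.star_apply] at h

/-- the (E10)-shape of reality: a real operator carries `Y = −X⋆` to `TY = −(TX)⋆`, pointwise. [cite: Balaban1985RegularSpaces, (1.91)–(1.92) p.91 (H′ on 𝔤-valued data), bookkeeping] -/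
theorem apply_eq_neg_star_of_isRealOpY {T : (X → 𝔸) →ₗ[ℂ] (Y → 𝔸)} (hT : IsRealOpY T) {Xf Yf : X → 𝔸} (hY : ∀ w, Yf w = -star (Xf w)) (y : Y) :
    T Yf y = -star (T Xf y) := by
  have hfun : Yf = -star Xf := funext fun w => by rw [hY, Pi.neg_apply, Pi.star_apply]
  rw [hfun, map_neg, hT.apply, Pi.neg_apply, Pi.star_apply]

end Generic

section Unitary

variable {N : ℕ} (i : KIdx d ℓ hd hL b₀ b₁) {G : Subgroup (Matrix (Fin N) (Fin N) ℂ)ˣ}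

/-- a `G`-valued configuration with `G ≤ U(N)` is unitary-valued. [cite: Balaban1985BackgroundPropagators, p.390 (G ⊂ U(N)), bookkeeping] -/
theorem mem_unitary_of_mem (hG : G ≤ B7Prop2Explicit.unitaryUnits (Matrix (Fin N) (Fin N) ℂ)) {U : CfgY (Matrix (Fin N) (Fin N) ℂ) i}
    (hU : ∀ μ x, U μ x ∈ G) : ∀ μ x, ((U μ x : (Matrix (Fin N) (Fin N) ℂ)ˣ) : Matrix (Fin N) (Fin N) ℂ) ∈ unitary (Matrix (Fin N) (Fin N) ℂ) :=
  fun μ x => B7Prop2Explicit.mem_unitaryUnits.mp (hG (hU μ x))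

/-- `G`-valued knit legs are unitary-valued. [cite: Balaban1985BackgroundPropagators, (3.19) p.393 (the contour variables U(Γ)), p.390 (G ⊂ U(N)), bookkeeping] -/
theorem parKnitY_mem_unitary (hG : G ≤ B7Prop2Explicit.unitaryUnits (Matrix (Fin N) (Fin N) ℂ)) {U : CfgY (Matrix (Fin N) (Fin N) ℂ) i}
    (hpar : ∀ z w : SiteY i, parKnitY i U z w ∈ G) (z w : SiteY i) :
    ((parKnitY i U z w : (Matrix (Fin N) (Fin N) ℂ)ˣ) : Matrix (Fin N) (Fin N) ℂ) ∈ unitary (Matrix (Fin N) (Fin N) ℂ) :=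
  B7Prop2Explicit.mem_unitaryUnits.mp (hG (hpar z w))

end Unitary

/-! ## §2 (E14): `Δ′_a(U; parKnitY)`, `G′(U; parKnitY)` and `η²G′` are real; hermitian data give hermitian values -/

section Reality

variable {N : ℕ} (i : KIdx d ℓ hd hL b₀ b₁) {G : Subgroup (Matrix (Fin N) (Fin N) ℂ)ˣ}

/-- ★ `Δ′_a(U)` AT THE KNIT LETTER IS REAL: `Δ′_a(Λ⋆) = (Δ′_aΛ)⋆` for `G ≤ U(N)`, a `G`-valued `U` with `G`-valued knit legs (def-Y's `deltaPrimeAY_isRealOpY` at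
`par := parKnitY`). [cite: Balaban1985BackgroundPropagators, (3.24) p.394, p.391 (hermitian-valued functions)] -/
theorem deltaPrimeAY_parKnitY_isRealOpY (hG : G ≤ B7Prop2Explicit.unitaryUnits (Matrix (Fin N) (Fin N) ℂ)) {U : CfgY (Matrix (Fin N) (Fin N) ℂ) i}
    (hU : ∀ μ x, U μ x ∈ G) (hpar : ∀ z w : SiteY i, parKnitY i U z w ∈ G) : IsRealOpY (deltaPrimeAY i (parKnitY i) U) :=
  deltaPrimeAY_isRealOpY i U (mem_unitary_of_mem i hG hU) (parKnitY i) (parKnitY_mem_unitary i hG hpar)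

/-- ★ `G′(U) = Δ′_a(U)⁻¹` AT THE KNIT LETTER IS REAL (def-Y's `GpY_isRealOpY` at `par := parKnitY`). [cite: Balaban1985BackgroundPropagators, p.394 («Its inverse is denoted by G′»), p.391] -/
theorem GpY_parKnitY_isRealOpY (hG : G ≤ B7Prop2Explicit.unitaryUnits (Matrix (Fin N) (Fin N) ℂ)) {U : CfgY (Matrix (Fin N) (Fin N) ℂ) i}
    (hU : ∀ μ x, U μ x ∈ G) (hpar : ∀ z w : SiteY i, parKnitY i U z w ∈ G) : IsRealOpY (GpY i (parKnitY i) U) :=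
  GpY_isRealOpY i U (mem_unitary_of_mem i hG hU) (parKnitY i) (parKnitY_mem_unitary i hG hpar)

/-- ★ the consumer's `η²·G′(U)` is real (`η² ∈ ℝ`). [cite: Balaban1985BackgroundPropagators, p.394 (G′); Balaban1985RegularSpaces, (1.95) p.92, (1.100) p.93] -/
theorem GpKnitY_isRealOpY (hG : G ≤ B7Prop2Explicit.unitaryUnits (Matrix (Fin N) (Fin N) ℂ)) {U : CfgY (Matrix (Fin N) (Fin N) ℂ) i}
    (hU : ∀ μ x, U μ x ∈ G) (hpar : ∀ z w : SiteY i, parKnitY i U z w ∈ G) (η : ℝ) : IsRealOpY (GpKnitY i η U) :=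
  (GpY_parKnitY_isRealOpY i hG hU hpar).smul_real (η * η)

/-- ★★★ **(E14) `gp_real` OF `B8Thm2TorusLetters.LettersAt`, AT THE KNIT LETTER.**  For `G ≤ U(N)`, a `G`-valued `U` with `G`-valued knit legs, every `η`,
every hermitian-valued `Λ` and every site `z`: `(GpKnitY η U Λ)(z)` is hermitian — `G′` acts on *«functions with values in N × N hermitian matrices»*.
[cite: Balaban1985BackgroundPropagators, p.391, (3.24) p.394, p.394 (G′); Balaban1985RegularSpaces, (1.100)–(1.102) p.93, Prop. 5 p.94 (λ 𝔤-valued, u′ = e^{iλ})] -/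
theorem isSelfAdjoint_GpKnitY_apply (hG : G ≤ B7Prop2Explicit.unitaryUnits (Matrix (Fin N) (Fin N) ℂ)) {U : CfgY (Matrix (Fin N) (Fin N) ℂ) i}
    (hU : ∀ μ x, U μ x ∈ G) (hpar : ∀ z w : SiteY i, parKnitY i U z w ∈ G) (η : ℝ) {Λ : SiteY i → Matrix (Fin N) (Fin N) ℂ}
    (hΛ : ∀ w, IsSelfAdjoint (Λ w)) (z : SiteY i) : IsSelfAdjoint (GpKnitY i η U Λ z) :=
  isSelfAdjoint_apply_of_isRealOpY (GpKnitY_isRealOpY i hG hU hpar η) hΛ z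

/-- (E14) for the unscaled `G′(U; parKnitY)`. [cite: Balaban1985BackgroundPropagators, p.391, p.394 (G′)] -/
theorem isSelfAdjoint_GpY_parKnitY_apply (hG : G ≤ B7Prop2Explicit.unitaryUnits (Matrix (Fin N) (Fin N) ℂ)) {U : CfgY (Matrix (Fin N) (Fin N) ℂ) i}
    (hU : ∀ μ x, U μ x ∈ G) (hpar : ∀ z w : SiteY i, parKnitY i U z w ∈ G) {Λ : SiteY i → Matrix (Fin N) (Fin N) ℂ}
    (hΛ : ∀ w, IsSelfAdjoint (Λ w)) (z : SiteY i) : IsSelfAdjoint (GpY i (parKnitY i) U Λ z) :=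
  isSelfAdjoint_apply_of_isRealOpY (GpY_parKnitY_isRealOpY i hG hU hpar) hΛ z

/-- (E14) in the (E10)-shape: `Y = −X⋆` pointwise ⇒ `GpKnitY Y = −(GpKnitY X)⋆` pointwise. [cite: Balaban1985BackgroundPropagators, p.391, p.394 (G′); Balaban1985RegularSpaces, (1.91)–(1.92) p.91, bookkeeping] -/
theorem GpKnitY_apply_eq_neg_star (hG : G ≤ B7Prop2Explicit.unitaryUnits (Matrix (Fin N) (Fin N) ℂ)) {U : CfgY (Matrix (Fin N) (Fin N) ℂ) i}
    (hU : ∀ μ x, U μ x ∈ G) (hpar : ∀ z w : SiteY i, parKnitY i U z w ∈ G) (η : ℝ) {Xf Yf : SiteY i → Matrix (Fin N) (Fin N) ℂ}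
    (hY : ∀ w, Yf w = -star (Xf w)) (z : SiteY i) : GpKnitY i η U Yf z = -star (GpKnitY i η U Xf z) :=
  apply_eq_neg_star_of_isRealOpY (GpKnitY_isRealOpY i hG hU hpar η) hY z

/-- `Δ′_a(U; parKnitY)` maps hermitian-valued functions to hermitian-valued functions. [cite: Balaban1985BackgroundPropagators, (3.24) p.394, p.391] -/
theorem isSelfAdjoint_deltaPrimeAY_parKnitY_apply (hG : G ≤ B7Prop2Explicit.unitaryUnits (Matrix (Fin N) (Fin N) ℂ))
    {U : CfgY (Matrix (Fin N) (Fin N) ℂ) i} (hU : ∀ μ x, U μ x ∈ G) (hpar : ∀ z w : SiteY i, parKnitY i U z w ∈ G)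
    {Λ : SiteY i → Matrix (Fin N) (Fin N) ℂ} (hΛ : ∀ w, IsSelfAdjoint (Λ w)) (z : SiteY i) : IsSelfAdjoint (deltaPrimeAY i (parKnitY i) U Λ z) :=
  isSelfAdjoint_apply_of_isRealOpY (deltaPrimeAY_parKnitY_isRealOpY i hG hU hpar) hΛ z

/-- the covariant gradient `∇_{U,μ}` of a hermitian-valued function is hermitian-valued at a `G`-valued `U`, `G ≤ U(N)` (dag-n06-j's `conjTranspose_cdS`).
[cite: Balaban1985BackgroundPropagators, (3.3) p.390, p.391 (hermitian values)] -/
theorem isSelfAdjoint_cdS_apply (hG : G ≤ B7Prop2Explicit.unitaryUnits (Matrix (Fin N) (Fin N) ℂ)) {U : CfgY (Matrix (Fin N) (Fin N) ℂ) i}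
    (hU : ∀ μ x, U μ x ∈ G) {Φ : SiteY i → Matrix (Fin N) (Fin N) ℂ} (hΦ : ∀ w, IsSelfAdjoint (Φ w)) (μ : Fin (d + 1)) (z : SiteY i) :
    IsSelfAdjoint (cdS i U μ Φ z) := by
  have hfun : (fun w => (Φ w)ᴴ) = Φ := funext fun w => (hΦ w).star_eq
  rw [IsSelfAdjoint, Matrix.star_eq_conjTranspose, conjTranspose_cdS i U (mem_unitary_of_mem i hG hU) μ Φ z, hfun]

/-- (E14) for the gradient line of (E12): `∇_{U,μ}(GpKnitY η U Λ)` is hermitian-valued for hermitian-valued `Λ`. [cite: Balaban1985BackgroundPropagators, (3.3) p.390, p.391, (3.42) p.397] -/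
theorem isSelfAdjoint_cdS_GpKnitY_apply (hG : G ≤ B7Prop2Explicit.unitaryUnits (Matrix (Fin N) (Fin N) ℂ)) {U : CfgY (Matrix (Fin N) (Fin N) ℂ) i}
    (hU : ∀ μ x, U μ x ∈ G) (hpar : ∀ z w : SiteY i, parKnitY i U z w ∈ G) (η : ℝ) {Λ : SiteY i → Matrix (Fin N) (Fin N) ℂ}
    (hΛ : ∀ w, IsSelfAdjoint (Λ w)) (μ : Fin (d + 1)) (z : SiteY i) : IsSelfAdjoint (cdS i U μ (GpKnitY i η U Λ) z) :=
  isSelfAdjoint_cdS_apply i hG hU (fun w => isSelfAdjoint_GpKnitY_apply i hG hU hpar η hΛ w) μ z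

end Reality

/-! ## §3 (U1): the left-inverse law of `G′` at the knit letter, read through the consumer's letters at box points -/

section LeftInv

variable {N : ℕ} (i : KIdx d ℓ hd hL b₀ b₁) {G : Subgroup (Matrix (Fin N) (Fin N) ℂ)ˣ}

/-- the consumer's `Δ_U g + Q′ᵀ𝔄Q′ g` at the box points, as a function on def-Y's carrier, IS `η⁻²·Δ′_a(U; parKnitY)Λ` (junction file 2, pointwise, packaged).
[cite: Balaban1985BackgroundPropagators, (3.24) p.394; Balaban1985RegularSpaces, (1.95) p.92, (1.29) p.81] -/
theorem consumer_deltaPrime_eq_smul {n : ℕ} (hlev : ∀ z : SiteY i, levY i z = n) (η : ℝ) (U : CfgY (Matrix (Fin N) (Fin N) ℂ) i)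
    (Λ : SiteY i → Matrix (Fin N) (Fin N) ℂ) :
    (fun z : SiteY i => covLap η (liftCfg U) (liftFun (Λ ∘ ⇑(boxEquiv i.hN))) z.1
        + QT (ℓ + 1) n (torusLam n) (liftCfg U)
            (awOp (cKnit (d := d) (ℓ := ℓ) η) fun j =>
              QprimeIter (zdBlocking (d + 1) (ℓ + 1)) (bgT (ℓ + 1) (liftCfg U)) j (liftFun (Λ ∘ ⇑(boxEquiv i.hN)))) z.1)
      = (((η⁻¹ * η⁻¹ : ℝ)) : ℂ) • deltaPrimeAY i (parKnitY i) U Λ := by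
  funext z
  rw [deltaPrime_junction_at_box i hlev η U Λ z, Pi.smul_apply, Complex.coe_smul]

/-- ★★★ **(U1) `gp_left_bdd` OF `B8Thm2TorusLetters.LettersAt`, AT THE KNIT LETTER, EXACTLY.**  On a constant-level member (`∀ z, j(z) = n`), for `G ≤ U(N)`,
a `G`-valued `U` with `G`-valued knit legs and `η ≠ 0`: with `g = liftFun (Λ ∘ chart)` and `U₀ = liftCfg U`, the consumer's Green's operator applied to the
consumer's `Δ_U g + Q′ᵀ𝔄Q′ g` (read at the box points) returns `Λ` — `G′(U)Δ′_a(U) = 1` ([B9] p. 394) through (E3)∕(E4)∕(E5); on the finite carrier every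
`g` is bounded, so the consumer's proviso «on bounded functions» is automatic. [cite: Balaban1985BackgroundPropagators, (3.24) p.394, p.394 («Its inverse is denoted by G′»), Thm 3.1 p.397; Balaban1985RegularSpaces, (1.95) p.92, (1.100) p.93, Prop. 5 p.94 (uniqueness)] -/
theorem knit_U1_at_box {n : ℕ} (hlev : ∀ z : SiteY i, levY i z = n) (hG : G ≤ B7Prop2Explicit.unitaryUnits (Matrix (Fin N) (Fin N) ℂ))
    {U : CfgY (Matrix (Fin N) (Fin N) ℂ) i} (hU : ∀ μ x, U μ x ∈ G) (hpar : ∀ z w : SiteY i, parKnitY i U z w ∈ G) {η : ℝ} (hη : η ≠ 0)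
    (Λ : SiteY i → Matrix (Fin N) (Fin N) ℂ) :
    GpKnitY i η U (fun z : SiteY i => covLap η (liftCfg U) (liftFun (Λ ∘ ⇑(boxEquiv i.hN))) z.1
        + QT (ℓ + 1) n (torusLam n) (liftCfg U)
            (awOp (cKnit (d := d) (ℓ := ℓ) η) fun j =>
              QprimeIter (zdBlocking (d + 1) (ℓ + 1)) (bgT (ℓ + 1) (liftCfg U)) j (liftFun (Λ ∘ ⇑(boxEquiv i.hN)))) z.1)
      = Λ := by
  rw [consumer_deltaPrime_eq_smul i hlev η U Λ, map_smul, GpKnitY_apply, GpY_deltaPrimeAY_parKnitY_apply i hG hU hpar Λ, smul_smul,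
    ← Complex.ofReal_mul]
  have h1 : η⁻¹ * η⁻¹ * (η * η) = 1 := by field_simp
  rw [h1, Complex.ofReal_one, one_smul]

/-- ★ UNIQUENESS for the consumer's equation at the box points: two data `Λ₁, Λ₂` whose `Δ_U g + Q′ᵀ𝔄Q′ g` agree at every box point coincide ([B8] Prop. 5's
uniqueness mechanism for the `G′`-letter: `G′` is a two-sided inverse). [cite: Balaban1985RegularSpaces, Prop. 5 p.94 (uniqueness); Balaban1985BackgroundPropagators, p.394 (G′ = (Δ′_a)⁻¹)] -/
theorem knit_solution_unique_at_box {n : ℕ} (hlev : ∀ z : SiteY i, levY i z = n) (hG : G ≤ B7Prop2Explicit.unitaryUnits (Matrix (Fin N) (Fin N) ℂ))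
    {U : CfgY (Matrix (Fin N) (Fin N) ℂ) i} (hU : ∀ μ x, U μ x ∈ G) (hpar : ∀ z w : SiteY i, parKnitY i U z w ∈ G) {η : ℝ} (hη : η ≠ 0)
    {Λ₁ Λ₂ : SiteY i → Matrix (Fin N) (Fin N) ℂ}
    (h : ∀ z : SiteY i,
      covLap η (liftCfg U) (liftFun (Λ₁ ∘ ⇑(boxEquiv i.hN))) z.1
          + QT (ℓ + 1) n (torusLam n) (liftCfg U)
              (awOp (cKnit (d := d) (ℓ := ℓ) η) fun j =>
                QprimeIter (zdBlocking (d + 1) (ℓ + 1)) (bgT (ℓ + 1) (liftCfg U)) j (liftFun (Λ₁ ∘ ⇑(boxEquiv i.hN)))) z.1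
        = covLap η (liftCfg U) (liftFun (Λ₂ ∘ ⇑(boxEquiv i.hN))) z.1
          + QT (ℓ + 1) n (torusLam n) (liftCfg U)
              (awOp (cKnit (d := d) (ℓ := ℓ) η) fun j =>
                QprimeIter (zdBlocking (d + 1) (ℓ + 1)) (bgT (ℓ + 1) (liftCfg U)) j (liftFun (Λ₂ ∘ ⇑(boxEquiv i.hN)))) z.1) :
    Λ₁ = Λ₂ := by
  rw [← knit_U1_at_box i hlev hG hU hpar hη Λ₁, ← knit_U1_at_box i hlev hG hU hpar hη Λ₂]
  exact congrArg (GpKnitY i η U) (funext h)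

/-- the consumer's Green's operator at the knit letter is injective for `η ≠ 0` (`Δ′_a(U) G′(U) = 1`). [cite: Balaban1985BackgroundPropagators, p.394 (G′ = (Δ′_a)⁻¹), (3.25) p.394] -/
theorem GpKnitY_injective (hG : G ≤ B7Prop2Explicit.unitaryUnits (Matrix (Fin N) (Fin N) ℂ)) {U : CfgY (Matrix (Fin N) (Fin N) ℂ) i}
    (hU : ∀ μ x, U μ x ∈ G) (hpar : ∀ z w : SiteY i, parKnitY i U z w ∈ G) {η : ℝ} (hη : η ≠ 0) : Function.Injective (GpKnitY i η U) := by
  intro X₁ X₂ h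
  have hc : (((η * η : ℝ)) : ℂ) ≠ 0 := Complex.ofReal_ne_zero.mpr (mul_ne_zero hη hη)
  have h' : GpY i (parKnitY i) U X₁ = GpY i (parKnitY i) U X₂ := by
    rw [GpKnitY_apply, GpKnitY_apply] at h
    exact smul_right_injective _ hc h
  rw [← deltaPrimeAY_GpY_parKnitY_apply i hG hU hpar X₁, ← deltaPrimeAY_GpY_parKnitY_apply i hG hU hpar X₂, h']

end LeftInv

end Literature.MathematicalPhysics.QuantumFieldTheory.Balaban1983to89.B9B8KnitLetterRealityLeftInv

end
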